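import Summits.NavierStokesRegularity.NavierStokesRegularity.Theses.PerpetualPump

/-!
# PerpetualPump route — glue item `PumpChain`

`PumpChain := CircuitPump → PumpTransfer → AveragedTypeIBlowup` (item stmt-NavierStokesRegularity-14768
of route-NavierStokesRegularity-PerpetualPump, the route header's "Intended proof: CircuitPump +
PumpTransfer"): the ODE perpetual pump (crux `CircuitPump`) and the ODE ⇒ PDE transfer (crux
`PumpTransfer`) compose to the PDE perpetual pump (crux `AveragedTypeIBlowup`).  `PumpTransfer` is
by construction the implication `CircuitPump → AveragedTypeIBlowup` with both sides inlined verbatim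
in the route file (`PumpTransfer ↔ (CircuitPump → AveragedTypeIBlowup)` is `Iff.rfl`), so the
composition is modus ponens.  This places `CircuitPump ∧ PumpTransfer` on the NEGATIVE side of the
route's `closes` cone (`⇒ AveragedTypeIBlowup ⇒ ¬Thesis`); it claims nothing more.
-/

-- the nested summit namespace `…NavierStokesRegularity.NavierStokesRegularity…` is the tree's layout (D-0017)
set_option linter.dupNamespace false

namespace Summit.NavierStokesRegularity.NavierStokesRegularity.Theorems

open Summit.NavierStokesRegularity.NavierStokesRegularity.Theses

/-- Glue item `PumpChain` (stmt-NavierStokesRegularity-14768) of route PerpetualPump: the ODE pump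
and the ODE ⇒ PDE transfer give the PDE perpetual pump,
`CircuitPump → PumpTransfer → AveragedTypeIBlowup`.  Proof: modus ponens — `PumpTransfer` unfolds,
definitionally, to `CircuitPump → AveragedTypeIBlowup`. [folklore] -/
theorem perpetualPump_pumpChain_proof : PerpetualPump.PumpChain := by
  unfold PerpetualPump.PumpChain
  intro hP hT
  exact hT hP

end Summit.NavierStokesRegularity.NavierStokesRegularity.Theorems
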